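import Literature.InformationTheory.Coding.LDPCEnsembleNoLightWords
import Literature.InformationTheory.Coding.LDPCCheckSplitting
import Literature.InformationTheory.Coding.DualDistance
import HarnessLib

/-!
# Asymptotically good binary LDPC codes exist (Gallager 1963; via unique-neighbour expansion, Sipser–Spielman 1996)

This file PROVES the existence theorem usually credited to Gallager's 1963 monograph (random ensembles of
low-density parity-check codes contain codes whose minimum distance grows linearly with the block length), in the
explicit bounded-weight form needed by Tillich–Zémor's hypergraph-product theorem ("any family of classical
asymptotically good LDPC codes of fixed rate yields …", TZ 2014 Thm 1):

* `exists_goodLDPCMatrix` — for every `n ≥ 1` there is a FULL-RANK binary `r × 2n` parity-check matrix `H` with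
  `8r ≤ 15n` (so the code `ker H` has dimension `2n − r ≥ n/8`, rate `≥ 1/16`), every ROW of weight `≤ 8`, every
  COLUMN of weight `≤ 4`, and every non-zero `v` with `Hv = 0` of weight `> n/650` (relative distance `≥ 1/1300`);
* `exists_goodLDPCMatrix_minDist` — the same with the distance clause as `⌊n/650⌋ + 1 ≤ minDist (ker H)`.

Proof = the two companion files: a member of Gallager's bit-regular ensemble without light kernel words
(`LDPCEnsembleNoLightWords.lean`, the Sipser–Spielman / Richardson–Urbanke unique-neighbour count), its checks split
into checks of degree `≤ 8` (`LDPCCheckSplitting.lean`: the split code is a subcode, so the weight bound is inherited,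
and the rank only drops), then a full-rank selection of rows. The constants `1/16`, `1/1300`, `8`, `4` are this proof's
(generous) constants, not Gallager's.

References: R. G. Gallager, *Low-Density Parity-Check Codes*, MIT Press 1963, Ch. 2; M. Sipser, D. A. Spielman,
*Expander codes*, IEEE TIT 42 (1996), Thm 7; T. Richardson, R. Urbanke, *Modern Coding Theory* (CUP 2008), Thms 8.2, 8.7.
-/

namespace Literature.InformationTheory.Coding

open Finset Matrix Literature.Computability.MetaComplexity

/-- **Asymptotically good LDPC codes exist (Gallager 1963), explicit bounded-weight form.** For every `n ≥ 1` there
are `r` and a binary `r × 2n` matrix `H` of full rank `r` with `8r ≤ 15n`, all row weights `≤ 8`, all column weights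
`≤ 4`, such that every non-zero `v ∈ 𝔽₂^{2n}` with `H v = 0` has Hamming weight `> n/650`. Hence the codes `ker H`
form a family of `(4,8)`-bounded LDPC codes of rate `≥ 1/16` and relative distance `≥ 1/1300` — an asymptotically
good LDPC family. (Gallager: "the minimum distance of almost all codes in the ensemble grows linearly with block
length"; proved here by the Sipser–Spielman unique-neighbour argument on a random bit-regular graph.)
[cite: Gallager1963, Ch. 2 (random ensemble of low-density parity-check codes: minimum distance linear in the block length for almost all codes)] [cite: SipserSpielman1996, Thm 7 (expansion `> 1/2` of the variable sets ⇒ relative minimum distance `≥ α`; quoted as Blake 2024, Thm 11.14, p. 279)] [cite: RichardsonUrbanke2008, Thm 8.2 (p. 428) and Thm 8.7 (§8.4, p. 431)] -/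
theorem exists_goodLDPCMatrix {n : ℕ} (hn : 1 ≤ n) :
    ∃ (r : ℕ) (H : Matrix (Fin r) (Fin (2 * n)) (ZMod 2)),
      H.rank = r ∧ 8 * r ≤ 15 * n ∧ (∀ i, hammingNorm (H i) ≤ 8) ∧ (∀ j, hammingNorm (fun i => H i j) ≤ 4) ∧
      ∀ v : Fin (2 * n) → ZMod 2, H *ᵥ v = 0 → v ≠ 0 → n / 650 < hammingNorm v := by
  classical
  obtain ⟨ω, hω⟩ := exists_sample_no_light_kernel hn
  -- the split matrix: checks of degree `≤ 8`, bits of degree `≤ 4`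
  set M := splitMatrix ω 8 with hM
  obtain ⟨e, he, hrank, hker⟩ := exists_fullRank_rows M
  refine ⟨M.rank, M.submatrix e id, hrank, ?_, fun i => ?_, fun j => ?_, fun v hv hv0 => ?_⟩
  · -- rank bound: `rank M ≤ (2n·4 + 7n)/8 = 15n/8`
    have h : M.rank ≤ (2 * n * 4 + (8 - 1) * n) / 8 := rank_splitMatrix_le ω (b := 8) (by norm_num)
    have h' : (2 * n * 4 + (8 - 1) * n) = 15 * n := by ring
    rw [h'] at h
    have := Nat.div_mul_le_self (15 * n) 8
    omega
  · rw [hammingNorm_submatrix_row]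
    exact hammingNorm_splitMatrix_row_le ω (by norm_num) _
  · exact (hammingNorm_submatrix_col_le M he j).trans (hammingNorm_splitMatrix_col_le ω 8 j)
  · have hMv : M *ᵥ v = 0 := (hker v).1 hv
    have hcomb : ∀ j, combVec ω v j = 0 := combVec_eq_zero_of_splitMatrix_mulVec hMv
    have := hω v hv0 hcomb
    -- `vsupp v` is the support counted by `hammingNorm`
    simpa [vsupp, hammingNorm] using this

/-- The same existence theorem with the distance clause in terms of the tree's `minDist`: the code
`ker H ≤ 𝔽₂^{2n}` has minimum distance `≥ ⌊n/650⌋ + 1`.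
[cite: Gallager1963, Ch. 2 (minimum distance of almost all codes of the ensemble)] [cite: RichardsonUrbanke2008, Thm 8.2 (p. 428)] -/
theorem exists_goodLDPCMatrix_minDist {n : ℕ} (hn : 1 ≤ n) :
    ∃ (r : ℕ) (H : Matrix (Fin r) (Fin (2 * n)) (ZMod 2)),
      H.rank = r ∧ 8 * r ≤ 15 * n ∧ (∀ i, hammingNorm (H i) ≤ 8) ∧ (∀ j, hammingNorm (fun i => H i j) ≤ 4) ∧
      ((n / 650 + 1 : ℕ) : ℕ∞) ≤ minDist (LinearMap.ker H.mulVecLin) := by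
  obtain ⟨r, H, h1, h2, h3, h4, h5⟩ := exists_goodLDPCMatrix hn
  refine ⟨r, H, h1, h2, h3, h4, le_minDist_iff.2 fun v hv hv0 => ?_⟩
  have := h5 v hv hv0
  exact_mod_cast this

end Literature.InformationTheory.Coding
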